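import Summits.KontsevichZagierPeriods.KontsevichZagierPeriods.Theorems.SoloInformedKappaSpan
import Summits.KontsevichZagierPeriods.KontsevichZagierPeriods.Theorems.SoloInformedArcCusp
import Summits.KontsevichZagierPeriods.KontsevichZagierPeriods.Theorems.SoloInformedRungTwo
import Summits.KontsevichZagierPeriods.KontsevichZagierPeriods.Theorems.SoloInformedPlanarBands

/-!
# Planar volumes are signed sums of `κ̃` of Nash symbols (Rung 2, file E5b)

Solo programme `solo-KontsevichZagierPeriods-informed`, steps L2–L4 of `paper/rung2-v2.md`,
assembled: **`SoloInformedPlanarPieces` holds** (`soloInformed_planarPieces`).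

For an arc `ρ = [(a, b), g]` produced by the planar reduction (file D: `g` continuous, bounded,
`ℚ`-semialgebraic, `a < b` algebraic) we take a Bezout relation `A p + B ∂_y p = c₁` (file E1),
the finite algebraic bad set `Z = {t | ∂_y p(t, g t) = 0}`, and prove by induction on a finite
set containing the bad points that `(⟦ρ|_{(α, β)}⟧, 0)` lies in the subgroup of `V` generated by
the `κ̃(σ)` (`σ` Nash symbols) for all algebraic `a ≤ α < β ≤ b`: an interval free of bad points is
cut
at two rational points `q < q'` into a cusp piece at `α` (file E4d), a good compact piece `[q, q']`
(file E3) and a cusp piece at `β`; an interval containing a point `c` of the finite set is cut at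
`c`. All cuts are Kontsevich–Zagier domain additivity modulo null sets. Summing over the arcs of
file D gives `SoloInformedPlanarPieces`.
[Kontsevich–Zagier 2001, §1.2; Huber–Wüstholz 2022, §13.1]
-/

noncomputable section

open Set Filter Topology MeasureTheory
open scoped Polynomial
open Literature.NumberTheory.Transcendental Literature.NumberTheory.Transcendental.KZ
open Literature.NumberTheory.Transcendental.CurvePeriods Literature.ModelTheory.ExponentialFields

namespace Summit.KontsevichZagierPeriods.KontsevichZagierPeriods.Theorems

/-! ## 1. Arcs with a Bezout relation -/

/-- **An arc**: `ρ = [(a, b), g]`, `a < b` algebraic, `g` continuous and bounded, with a Bezout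
relation `A p + B ∂_y p = c₁`, `p(t, g t) = 0`. -/
structure SoloInformedArc where
  /-- The arc representation. -/
  ρ : IntegralRep 1
  /-- Left end. -/
  a : ℝ
  /-- Right end. -/
  b : ℝ
  /-- The arc is non-degenerate. -/
  lt : a < b
  /-- The left end is algebraic. -/
  a_alg : IsAlgebraic ℚ a
  /-- The right end is algebraic. -/
  b_alg : IsAlgebraic ℚ b
  /-- The domain is `(a, b)`. -/
  dom : ρ.domain = soloInformedIoo1 a b
  /-- The integrand is continuous. -/
  cont : ContinuousOn ρ.integrand ρ.domain
  /-- A bound for the integrand. -/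
  M : ℝ
  /-- The integrand is bounded. -/
  bdd : ∀ t ∈ Ioo a b, |soloInformedArcFun ρ t| ≤ M
  /-- The relation. -/
  p : ℚ[X][X]
  /-- First Bezout coefficient. -/
  A : ℚ[X][X]
  /-- Second Bezout coefficient. -/
  B : ℚ[X][X]
  /-- The Bezout element. -/
  c₁ : ℚ[X]
  /-- The Bezout element is non-zero. -/
  c₁_ne : c₁ ≠ 0
  /-- The Bezout identity. -/
  bez : A * p + B * Polynomial.derivative p = Polynomial.C c₁
  /-- `p(t, g t) = 0` on `(a, b)`. -/
  rel : ∀ t ∈ Ioo a b, soloInformedEvR t (soloInformedArcFun ρ t) p = 0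

namespace SoloInformedArc

variable (E : SoloInformedArc)

/-- `(α, β) ⊆ (a, b)` for `a ≤ α`, `β ≤ b`. -/
theorem Ioo1_subset {α β : ℝ} (h₁ : E.a ≤ α) (h₂ : β ≤ E.b) :
    soloInformedIoo1 α β ⊆ E.ρ.domain := by
  intro x hx
  rw [E.dom, soloInformed_mem_Ioo1]
  rw [soloInformed_mem_Ioo1] at hx
  exact ⟨lt_of_le_of_lt h₁ hx.1, lt_of_lt_of_le hx.2 h₂⟩

/-- The sub-arc `ρ|_{(α, β)}`. -/
def sub {α β : ℝ} (hα : IsAlgebraic ℚ α) (hβ : IsAlgebraic ℚ β) (h₁ : E.a ≤ α)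
    (h₂ : β ≤ E.b) : IntegralRep 1 :=
  E.ρ.restrict (soloInformedIoo1 α β) (soloInformed_isSemialgebraic_Ioo1 hα hβ)
    (E.Ioo1_subset h₁ h₂)

/-- **Cutting a sub-arc at an algebraic point** (domain additivity modulo the null point). -/
theorem per_sub_split {α β c : ℝ} (hα : IsAlgebraic ℚ α) (hβ : IsAlgebraic ℚ β)
    (hc : IsAlgebraic ℚ c) (h₁ : E.a ≤ α) (h₂ : β ≤ E.b) (hαc : α < c)
    (hcβ : c < β) :
    soloInformedPer (E.sub hα hβ h₁ h₂) =
      soloInformedPer (E.sub hα hc h₁ (hcβ.le.trans h₂)) +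
        soloInformedPer (E.sub hc hβ (h₁.trans hαc.le) h₂) := by
  set r := E.sub hα hβ h₁ h₂ with hr
  have hU : IsSemialgebraic ℚ (soloInformedIoo1 α c ∪ soloInformedIoo1 c β) :=
    (soloInformed_isSemialgebraic_Ioo1 hα hc).union (soloInformed_isSemialgebraic_Ioo1 hc hβ)
  have hUr : soloInformedIoo1 α c ∪ soloInformedIoo1 c β ⊆ r.domain := by
    rintro x (hx | hx)
    · rw [soloInformed_mem_Ioo1] at hx
      exact ⟨hx.1, hx.2.trans hcβ⟩
    · rw [soloInformed_mem_Ioo1] at hx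
      exact ⟨hαc.trans hx.1, hx.2⟩
  have e₀ : of r - of (r.restrict _ hU hUr) ∈ relations := by
    refine r.of_sub_of_restrict_mem_relations _ hUr ?_
    refine measure_mono_null (fun x hx => ?_) (volume_setOf_last_eq_zero (n := 0) c)
    simp only [hr, sub, IntegralRep.domain_restrict, Set.mem_sdiff, mem_union, soloInformed_mem_Ioo1,
      mem_Ioo, not_or, not_and, not_lt] at hx
    obtain ⟨⟨hx1, hx2⟩, hx3, hx4⟩ := hx
    show x 0 = c
    by_contra hne
    rcases lt_or_gt_of_ne hne with h | h
    · exact absurd (hx3 hx1) (not_le.2 h)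
    · exact absurd (hx4 h) (not_le.2 hx2)
  have e₁ : of (r.restrict _ hU hUr) - of (E.sub hα hc h₁ (hcβ.le.trans h₂)) -
      of (E.sub hc hβ (h₁.trans hαc.le) h₂) ∈ relations := by
    refine domainAddRel_subset_relations
      ⟨1, r.restrict _ hU hUr, E.sub hα hc h₁ (hcβ.le.trans h₂),
        E.sub hc hβ (h₁.trans hαc.le) h₂, rfl, ?_, fun x _ => rfl, fun x _ => rfl, rfl⟩
    rw [show ((E.sub hα hc h₁ (hcβ.le.trans h₂)).domain ∩
        (E.sub hc hβ (h₁.trans hαc.le) h₂).domain : Set (Fin 1 → ℝ)) = ∅ from ?_,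
      measure_empty]
    ext x
    simp only [sub, IntegralRep.domain_restrict, mem_inter_iff, soloInformed_mem_Ioo1, mem_Ioo,
      mem_empty_iff_false, iff_false, not_and]
    intro _ h2 h3
    linarith
  have e : of r - of (E.sub hα hc h₁ (hcβ.le.trans h₂)) -
      of (E.sub hc hβ (h₁.trans hαc.le) h₂) ∈ relations := by
    have : of r - of (E.sub hα hc h₁ (hcβ.le.trans h₂)) -
        of (E.sub hc hβ (h₁.trans hαc.le) h₂) =
        (of r - of (r.restrict _ hU hUr)) + (of (r.restrict _ hU hUr) -
          of (E.sub hα hc h₁ (hcβ.le.trans h₂)) -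
          of (E.sub hc hβ (h₁.trans hαc.le) h₂)) := by
      abel
    rw [this]
    exact add_mem e₀ e₁
  exact soloInformedPer_add e

/-! ### Intervals free of bad points -/

/-- The cusp piece at an end of a sub-arc (`ϵ = 1`: at `α` from the right; `ϵ = −1`: at `β`
from the left). -/
def cusp {α β : ℝ} (h₁ : E.a ≤ α) (h₂ : β ≤ E.b) (hαβ : α < β) (c₀ : ℝ)
    (hc₀ : IsAlgebraic ℚ c₀) (ϵ : ℚ) (hϵ : ϵ = 1 ∨ ϵ = -1)
    (hside : ∀ x ∈ Ioo (0 : ℝ) (β - α), c₀ + ϵ * x ∈ Ioo α β) :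
    SoloInformedCuspPiece where
  ρ := E.ρ
  a := E.a
  b := E.b
  dom := E.dom
  cont := E.cont
  M := E.M
  bdd := E.bdd
  p := E.p
  A := E.A
  B := E.B
  c₁ := E.c₁
  c₁_ne := E.c₁_ne
  bez := E.bez
  rel := E.rel
  c₀ := c₀
  c₀_alg := hc₀
  ϵ := ϵ
  sign := hϵ
  η := β - α
  η_pos := sub_pos.2 hαβ
  side x hx := by
    have h := hside x hx
    exact ⟨lt_of_le_of_lt h₁ h.1, lt_of_lt_of_le h.2 h₂⟩

/-- **A sub-arc free of bad points is in the span**: cusp piece at `α`, good piece `[q, q']`,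
cusp piece at `β`. -/
theorem per_sub_mem_of_good {α β : ℝ} (hα : IsAlgebraic ℚ α) (hβ : IsAlgebraic ℚ β)
    (h₁ : E.a ≤ α) (h₂ : β ≤ E.b) (hαβ : α < β)
    (hgood : ∀ t ∈ Ioo α β,
      soloInformedEvR t (soloInformedArcFun E.ρ t) (Polynomial.derivative E.p) ≠ 0) :
    soloInformedPer (E.sub hα hβ h₁ h₂) ∈ soloInformedKappaSpan := by
  -- the two cusp pieces
  let PL : SoloInformedCuspPiece := E.cusp h₁ h₂ hαβ α hα 1 (Or.inl rfl) fun x hx => by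
    simp only [Rat.cast_one, one_mul, mem_Ioo] at hx ⊢
    constructor <;> linarith [hx.1, hx.2]
  let PR : SoloInformedCuspPiece := E.cusp h₁ h₂ hαβ β hβ (-1) (Or.inr rfl) fun x hx => by
    simp only [Rat.cast_neg, Rat.cast_one, neg_mul, one_mul, mem_Ioo] at hx ⊢
    constructor <;> linarith [hx.1, hx.2]
  obtain ⟨κL, hκL, hadmL⟩ := PL.exists_admissible
  obtain ⟨κR, hκR, hadmR⟩ := PR.exists_admissible
  have hκLq : ∀ q : ℚ, PL.κ q = q - α := fun q => by
    show ((1 : ℚ) : ℝ) * ((q : ℝ) - α) = q - α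
    push_cast
    ring
  have hκRq : ∀ q : ℚ, PR.κ q = β - q := fun q => by
    show ((-1 : ℚ) : ℝ) * ((q : ℝ) - β) = β - q
    push_cast
    ring
  -- the two rational cut points
  obtain ⟨q, hq1, hq2⟩ := exists_rat_btwn (lt_min (lt_add_of_pos_right α hκL)
    (show α < (α + β) / 2 by linarith))
  obtain ⟨q', hq'1, hq'2⟩ := exists_rat_btwn (max_lt (sub_lt_self β hκR)
    (show (α + β) / 2 < β by linarith))
  have hq2a : (q : ℝ) < α + κL := hq2.trans_le (min_le_left _ _)
  have hq2b : (q : ℝ) < (α + β) / 2 := hq2.trans_le (min_le_right _ _)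
  have hq'1a : β - κR < q' := (le_max_left _ _).trans_lt hq'1
  have hq'1b : (α + β) / 2 < q' := (le_max_right _ _).trans_lt hq'1
  have hqq' : (q : ℝ) < q' := hq2b.trans hq'1b
  have hqa : IsAlgebraic ℚ (q : ℝ) := isAlgebraic_algebraMap (q : ℚ)
  have hq'a : IsAlgebraic ℚ (q' : ℝ) := isAlgebraic_algebraMap (q' : ℚ)
  have hL : PL.Admissible q := hadmL q (by rw [hκLq]; linarith) (by rw [hκLq]; linarith)
  have hR : PR.Admissible q' := hadmR q' (by rw [hκRq]; linarith) (by rw [hκRq]; linarith)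
  -- the good piece
  let PG : SoloInformedGoodPiece :=
    { ρ := E.ρ, a := E.a, b := E.b, dom := E.dom, cont := E.cont, p := E.p, rel := E.rel
      u := q, v := q', lt := by exact_mod_cast hqq'
      sub := fun t ht => ⟨lt_of_le_of_lt h₁ (hq1.trans_le ht.1), lt_of_lt_of_le
        (ht.2.trans_lt hq'2) h₂⟩
      good := fun t ht => hgood t ⟨hq1.trans_le ht.1, ht.2.trans_lt hq'2⟩ }
  have hIG : soloInformedIoo1 (PG.u : ℝ) PG.v ⊆ PG.ρ.domain := fun x hx => by
    show x ∈ E.ρ.domain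
    rw [E.dom, soloInformed_mem_Ioo1]
    rw [soloInformed_mem_Ioo1] at hx
    exact ⟨lt_of_le_of_lt h₁ (hq1.trans hx.1), lt_of_lt_of_le (hx.2.trans hq'2) h₂⟩
  -- the three pieces are in the span
  have mL : soloInformedPer (E.sub hα hqa h₁ ((hqq'.trans hq'2).le.trans h₂)) ∈
      soloInformedKappaSpan := by
    have hset : soloInformedSide α (q : ℝ) 1 = soloInformedIoo1 α q := by
      simp only [soloInformedSide]
      rfl
    have h : SoloInformedCuspPiece.piece hL =
        E.sub hα hqa h₁ ((hqq'.trans hq'2).le.trans h₂) :=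
      soloInformed_restrict_congr E.ρ hset _ _ _ _
    rw [← h, show soloInformedPer (SoloInformedCuspPiece.piece hL) = _ from
      (SoloInformedCuspPiece.kappaTilde_eq hL).symm]
    exact soloInformed_kappaTilde_mem_span _ _
  have mG : soloInformedPer (E.sub hqa hq'a (h₁.trans hq1.le) (hq'2.le.trans h₂)) ∈
      soloInformedKappaSpan := by
    have h : PG.piece hIG = E.sub hqa hq'a (h₁.trans hq1.le) (hq'2.le.trans h₂) := rfl
    rw [← h, show soloInformedPer (PG.piece hIG) = _ from (PG.kappaTilde_eq hIG).symm]
    exact soloInformed_kappaTilde_mem_span _ _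
  have mR : soloInformedPer (E.sub hq'a hβ ((h₁.trans hq1.le).trans hqq'.le) h₂) ∈
      soloInformedKappaSpan := by
    have hset : soloInformedSide β (q' : ℝ) (-1) = soloInformedIoo1 (q' : ℝ) β := by
      simp only [soloInformedSide, if_neg (show (-1 : ℚ) ≠ 1 by norm_num)]
      rfl
    have h : SoloInformedCuspPiece.piece hR =
        E.sub hq'a hβ ((h₁.trans hq1.le).trans hqq'.le) h₂ :=
      soloInformed_restrict_congr E.ρ hset _ _ _ _
    rw [← h, show soloInformedPer (SoloInformedCuspPiece.piece hR) = _ from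
      (SoloInformedCuspPiece.kappaTilde_eq hR).symm]
    exact soloInformed_kappaTilde_mem_span _ _
  -- cut twice
  rw [E.per_sub_split hα hβ hqa h₁ h₂ hq1 (hqq'.trans hq'2),
    E.per_sub_split hqa hβ hq'a (h₁.trans hq1.le) h₂ hqq' hq'2]
  exact add_mem mL (add_mem mG mR)

/-! ### Induction on the bad points -/

/-- **Every sub-arc is in the span** (induction on a finite algebraic set containing the bad
points of the sub-arc). -/
theorem per_sub_mem_aux (Z : Finset ℝ) :
    ∀ {α β : ℝ} (hα : IsAlgebraic ℚ α) (hβ : IsAlgebraic ℚ β) (h₁ : E.a ≤ α)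
      (h₂ : β ≤ E.b), α < β → (∀ c ∈ Z, IsAlgebraic ℚ c) →
      (∀ t ∈ Ioo α β,
        soloInformedEvR t (soloInformedArcFun E.ρ t) (Polynomial.derivative E.p) = 0 → t ∈ Z) →
      soloInformedPer (E.sub hα hβ h₁ h₂) ∈ soloInformedKappaSpan := by
  classical
  induction Z using Finset.induction_on with
  | empty =>
    intro α β hα hβ h₁ h₂ hαβ _ hZ
    exact E.per_sub_mem_of_good hα hβ h₁ h₂ hαβ fun t ht h => by simpa using hZ t ht h
  | insert c Z hc ih =>
    intro α β hα hβ h₁ h₂ hαβ halg hZ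
    have halg' : ∀ c ∈ Z, IsAlgebraic ℚ c := fun c hc => halg c (Finset.mem_insert_of_mem hc)
    by_cases hcI : c ∈ Ioo α β
    · have hca : IsAlgebraic ℚ c := halg c (Finset.mem_insert_self c Z)
      rw [E.per_sub_split hα hβ hca h₁ h₂ hcI.1 hcI.2]
      refine add_mem (ih hα hca h₁ (hcI.2.le.trans h₂) hcI.1 halg' fun t ht h => ?_)
        (ih hca hβ (h₁.trans hcI.1.le) h₂ hcI.2 halg' fun t ht h => ?_)
      · have htZ := hZ t ⟨ht.1, ht.2.trans hcI.2⟩ h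
        rw [Finset.mem_insert] at htZ
        exact htZ.resolve_left (ne_of_lt ht.2)
      · have htZ := hZ t ⟨hcI.1.trans ht.1, ht.2⟩ h
        rw [Finset.mem_insert] at htZ
        exact htZ.resolve_left (ne_of_gt ht.1)
    · refine ih hα hβ h₁ h₂ hαβ halg' fun t ht h => ?_
      have htZ := hZ t ht h
      rw [Finset.mem_insert] at htZ
      exact htZ.resolve_left (by rintro rfl; exact hcI ht)

/-- **The arc is in the span.** -/
theorem per_mem : soloInformedPer E.ρ ∈ soloInformedKappaSpan := by
  obtain ⟨hfin, halg⟩ := soloInformed_badSet_finite E.c₁_ne E.bez E.rel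
  have h := E.per_sub_mem_aux hfin.toFinset E.a_alg E.b_alg le_rfl le_rfl E.lt
    (fun c hc => by
      rw [Set.Finite.mem_toFinset] at hc
      exact halg c hc.1 hc.2)
    (fun t ht h => by
      rw [Set.Finite.mem_toFinset]
      exact ⟨ht, h⟩)
  have e : of E.ρ - of (E.sub E.a_alg E.b_alg le_rfl le_rfl) ∈ relations := by
    refine E.ρ.of_sub_of_restrict_mem_relations _ _ ?_
    rw [E.dom, Set.sdiff_self]
    exact measure_empty
  rwa [soloInformedPer_congr e]

end SoloInformedArc

/-! ## 2. Arcs and planar volumes -/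

/-- **Arcs of the planar reduction are in the span.** -/
theorem soloInformed_arc_mem_span (ρ : IntegralRep 1) {a b : ℝ} (hab : a < b)
    (ha : IsAlgebraic ℚ a) (hb : IsAlgebraic ℚ b) (hdom : ρ.domain = {x | a < x 0 ∧ x 0 < b})
    (hcont : ContinuousOn ρ.integrand {x | a < x 0 ∧ x 0 < b})
    (hbdd : ∃ M : ℝ, ∀ x ∈ ρ.domain, 0 ≤ ρ.integrand x ∧ ρ.integrand x ≤ M) :
    soloInformedPer ρ ∈ soloInformedKappaSpan := by
  obtain ⟨M, hM⟩ := hbdd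
  have hdom' : ρ.domain = soloInformedIoo1 a b := hdom
  -- the graph of `g` over `(a, b)` is semialgebraic
  have hG : IsSemialgebraic ℚ
      {w : Fin 2 → ℝ | w 0 ∈ Ioo a b ∧ w 1 = soloInformedArcFun ρ (w 0)} := by
    have h := ρ.isSemialgebraicFunOn_integrand
    rw [IsSemialgebraicFunOn, setOf_exists_eq_snoc] at h
    have hset : {z : Fin (1 + 1) → ℝ | Fin.init z ∈ ρ.domain ∧
        z (Fin.last 1) = ρ.integrand (Fin.init z)} =
        {w : Fin 2 → ℝ | w 0 ∈ Ioo a b ∧ w 1 = soloInformedArcFun ρ (w 0)} := by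
      ext w
      have h0 : Fin.init w 0 = w 0 := rfl
      have h1 : w (Fin.last 1) = w 1 := rfl
      simp only [mem_setOf_eq, hdom', soloInformed_mem_Ioo1, h1, soloInformed_integrand_eq_arcFun,
        h0]
    rwa [hset] at h
  obtain ⟨p, A, B, c₁, -, hc₁, hbez, hrel⟩ :=
    soloInformed_exists_bezoutRelation (Set.Ioo_infinite hab) hG
  let E : SoloInformedArc :=
    { ρ := ρ, a := a, b := b, lt := hab, a_alg := ha, b_alg := hb, dom := hdom'
      cont := by rw [hdom]; exact hcont
      M := M
      bdd := fun t ht => by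
        have h := hM (fun _ => t) (by rw [hdom]; exact ht)
        rw [soloInformed_integrand_eq_arcFun] at h
        exact abs_le.2 ⟨by linarith [h.1, h.2], h.2⟩
      p := p, A := A, B := B, c₁ := c₁, c₁_ne := hc₁, bez := hbez, rel := hrel }
  exact E.per_mem

/-- **Planar volumes are signed sums of `κ̃` of Nash symbols** (`SoloInformedPlanarPieces`).
[Kontsevich–Zagier 2001, §1.2; Huber–Wüstholz 2022, §13.1] -/
theorem soloInformed_planarPieces : SoloInformedPlanarPieces := by
  intro r hK _ hr1
  obtain ⟨k, a, b, ρ, hab, ha, hb, hdom, hcont, hbdd, hrel⟩ :=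
    soloInformed_planarBands r hK hr1
  have hmem : soloInformedPer r ∈ soloInformedKappaSpan := by
    rw [soloInformedPer_sum Finset.univ hrel]
    exact sum_mem fun i _ =>
      soloInformed_arc_mem_span (ρ i) (hab i) (ha i) (hb i) (hdom i) (hcont i) (hbdd i)
  exact soloInformed_exists_sum_of_mem_span hmem

end Summit.KontsevichZagierPeriods.KontsevichZagierPeriods.Theorems
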